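/-
Copyright: cell pub-balaban-gaps (YM BLITZ Y1, track G1), seat g1-p2 GEN 10 (unit `pub-balaban-gaps-g1-p2`).  Row (D4) NODE O,
OBJECT ∕ MECHANISM level, CARRIER-GENERIC: the covariant RELATIVE LETTERS.  `D4WalkBlockCovariantDerivative` bounds each weighted covariant
letter `‖w∇_UT‖`, `‖w∇⁻_UT‖` of a kernel by its weighted flat letters block by block; here the two inequalities are assembled into the
statement the Cor. 3.5 ENDs consume: the flat weighted letter FAMILY `covBW ρ Λ = {1, 1, Λe^{ρ}}` of a kernel (any decay factor) gives the
covariant weighted letter family with the relative letters `covBU ρ Λ α = {1, 1 + 2α, (1 + α)Λe^{ρ} + Λα}` in the (3.37) window `α`.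
HONEST FRAMING: elementary; `U` a hypothesis SHAPE; nothing of Bałaban's constructed; (D4) NOT discharged (instance 0∕1); NOT BetaPertH,
NOT continuum, NOT Clay.
-/
import Summits.QuantumFields.BalabanUV.Gaps.D4WalkBlockCovariantDerivative

/-!
# `Gaps.D4WalkBlockCovariantDerivativeLetters` — the covariant relative letters `covBU` from the flat ones `covBW` (carrier-generic;
# cell pub-balaban-gaps, seat g1-p2 gen 10)

HONEST DEPENDENCY (cell pub-balaban, verbatim): continuum YM on T⁴ ⇐ BetaPertH ∧ nine spine estimates (0/9 proved);
BetaPertH ⇐ (D1) ∧ (D4) ∧ CAP+tail.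

* `covBU ρ Λ α`, `covBU_nonneg`, **`covDopU_letters_of_covDopW`**: `η > 0`, `w > 0`, `ηw ≤ 1`, backward ratio `w(x − e_μ) ≤ Λw(x)`, windows
  `Σ_b‖(U_μ(u,x) − 1)_{ab}‖ ≤ ηα·w(x)`, `Σ_b‖(U⁻_μ(u,y) − 1)_{ab}‖ ≤ ηα·w(y)`, flat letters `‖D̃_jT‖_{Y,Y′} ≤ covBW_j·A·e(Y,Y′)` for every `j`
  ⟹ `‖D̃^U_jT‖_{Y,Y′} ≤ covBU_j·A·e(Y,Y′)` for every `j` — for ANY kernel `T` and ANY nonnegative decay factor `e`, hence term by term for a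
  block walk expansion with its own walks and distances.
Consumer: `D4WalkBlockCovariantGaugeDerivMultiLevel` (the ENDs on [4]'s nested family).  Words of row (D4) UNCHANGED.

References: T. Bałaban, Comm. Math. Phys. **99** (1985) 389–434 [B9], Thm 3.1 (3.42) p. 397, (3.37) p. 396, (3.61) p. 402.
-/

noncomputable section

namespace Summit.QuantumFields.BalabanUV.Gaps.D4WalkBlockCovariantDerivativeLetters

open Metric
open scoped Matrix
open Literature.MathematicalPhysics.QuantumFieldTheory.Balaban1983to89
open Literature.MathematicalPhysics.QuantumFieldTheory.Balaban1983to89.B5TorusCover (UT)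
open Summit.QuantumFields.BalabanUV.Gaps.D4WalkBlock (blockNorm blockNorm_nonneg)
open Summit.QuantumFields.BalabanUV.Gaps.D4WalkBlockShiftAlgebra (fibD Sfw Sbw Dfw)
open Summit.QuantumFields.BalabanUV.Gaps.D4WalkBlockShiftWeighted (wOp covDopW covBW)
open Summit.QuantumFields.BalabanUV.Gaps.D4WalkBlockCovariantDerivative (covDf covDb covDopU blockNorm_wcovDf_le blockNorm_wcovDb_le)

section Generic

variable {X : Type} {F : Type} [Fintype X] [Fintype F] [DecidableEq X] [DecidableEq F] {ι : Type} [Fintype ι]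
variable {sh : ι → X ≃ X} {η : ℝ} {E : Type*} {U Ui : ι → E → X → Matrix F F ℂ} {w : X → ℝ}
variable {ν : ℕ} {Kv : Fin ν → ℕ}

/-- **The relative letters of the weighted COVARIANT family** from the flat ones `covBW ρ Λ = {1, 1, Λe^{ρ}}` and the window `α`:
`{1, 1 + 2α, (1 + α)Λe^{ρ} + Λα}`. -/
def covBU (ρ Λ α : ℝ) : Unit ⊕ (ι ⊕ ι) → ℝ
  | Sum.inl _ => 1
  | Sum.inr (Sum.inl _) => 1 + 2 * α
  | Sum.inr (Sum.inr _) => (1 + α) * (Λ * Real.exp ρ) + Λ * α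

omit [Fintype ι] in
/-- the covariant relative letters are nonnegative (`Λ, α ≥ 0`). -/
theorem covBU_nonneg {ρ Λ α : ℝ} (hΛ : 0 ≤ Λ) (hα : 0 ≤ α) (j : Unit ⊕ (ι ⊕ ι)) : 0 ≤ covBU ρ Λ α j := by
  rcases j with _ | (_ | _) <;> simp only [covBU] <;> positivity

omit [Fintype ι] in
/-- **THE COVARIANT LETTER FAMILY FROM THE FLAT ONE** (any kernel `T`, any decay factor `e ≥ 0`): `η > 0`, `w > 0`, `ηw ≤ 1`, backward
ratio `w(x − e_μ) ≤ Λw(x)`, windows `Σ_b‖(U_μ(u,x) − 1)_{ab}‖ ≤ ηα·w(x)`, `Σ_b‖(U⁻_μ(u,y) − 1)_{ab}‖ ≤ ηα·w(y)`, and the flat letters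
`‖D̃_jT‖_{Y,Y′} ≤ covBW_j·A·e(Y,Y′)` ⟹ `‖D̃^U_jT‖_{Y,Y′} ≤ covBU_j·A·e(Y,Y′)`. [cite: Balaban1985BackgroundPropagators, Thm 3.1 (3.42) p.397, (3.61) p.402] -/
theorem covDopU_letters_of_covDopW (cub : X → UT Kv) (hη : 0 < η) (hw : ∀ x, 0 < w x) (hηw : ∀ x, η * w x ≤ 1) {Λ : ℝ}
    (hΛ : 0 ≤ Λ) (hwb : ∀ μ x, w ((sh μ).symm x) ≤ Λ * w x) {α : ℝ} (hα : 0 ≤ α) (u : E)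
    (hU : ∀ μ x a, ∑ b, ‖(U μ u x - 1) a b‖ ≤ η * α * w x) (hUi : ∀ μ y a, ∑ b, ‖(Ui μ u y - 1) a b‖ ≤ η * α * w y)
    (T : Matrix (X × F) (X × F) ℂ) {A ρ : ℝ} (hA : 0 ≤ A) {e : UT Kv → UT Kv → ℝ} (he : ∀ Y Y', 0 ≤ e Y Y')
    (hflat : ∀ j Y Y', blockNorm (fun p : X × F => cub p.1) (fun p : X × F => cub p.1) (covDopW X F sh η w j * T) Y Y' ≤
      covBW (ι := ι) ρ Λ j * (A * e Y Y')) (j : Unit ⊕ (ι ⊕ ι)) (Y Y' : UT Kv) :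
    blockNorm (fun p : X × F => cub p.1) (fun p : X × F => cub p.1) (covDopU sh η U Ui w u j * T) Y Y' ≤
      covBU (ι := ι) ρ Λ α j * (A * e Y Y') := by
  have hAe : 0 ≤ A * e Y Y' := mul_nonneg hA (he Y Y')
  rcases j with v | (μ | μ)
  · simpa only [covDopU, covBU, covDopW, covBW] using hflat (Sum.inl v) Y Y'
  · have h1 := hflat (Sum.inr (Sum.inl μ)) Y Y'
    have h0 := hflat (Sum.inl ()) Y Y'
    simp only [covDopW, covBW, one_mul] at h1 h0
    have h := blockNorm_wcovDf_le (F := F) (sh := sh) cub μ hη hw hηw hα u (hU μ) T Y Y'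
    simp only [covDopU, covBU]
    calc _ ≤ _ := h
      _ ≤ (1 + α) * (A * e Y Y') + α * (A * e Y Y') :=
          add_le_add (mul_le_mul_of_nonneg_left h1 (by positivity)) (mul_le_mul_of_nonneg_left h0 hα)
      _ = _ := by ring
  · have h1 := hflat (Sum.inr (Sum.inr μ)) Y Y'
    have h0 := hflat (Sum.inl ()) Y Y'
    simp only [covDopW, covBW, one_mul] at h1 h0
    have h := blockNorm_wcovDb_le (F := F) (sh := sh) cub μ hη hw hηw hΛ (hwb μ) hα u (hUi μ) T Y Y'
    simp only [covDopU, covBU]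
    calc _ ≤ _ := h
      _ ≤ (1 + α) * (Λ * Real.exp ρ * (A * e Y Y')) + Λ * α * (A * e Y Y') :=
          add_le_add (mul_le_mul_of_nonneg_left h1 (by positivity)) (mul_le_mul_of_nonneg_left h0 (mul_nonneg hΛ hα))
      _ = _ := by ring

end Generic

end Summit.QuantumFields.BalabanUV.Gaps.D4WalkBlockCovariantDerivativeLetters

end
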